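import Summits.QuantumFields.YangMills.Theorems.UnitScaleTiltProp7SectET3RealityPInvT3
import Summits.QuantumFields.YangMills.Theorems.UnitScaleTiltProp7SectET3DeltaOneT3PInvGlue
import Summits.QuantumFields.YangMills.Theorems.UnitScaleTiltProp7SectET3DeltaOneT3JTermRowsRegPr
import HarnessLib

/-!
# Route `UnitScaleTilt`, crux K1 child «MinimiserStabilityRegPr» (stmt-QuantumFields-19200), stub `stub_existenceMinimalOrbit` (EX), route (α) — (C2′) PINV CASCADE, FILE P3 PART 2a
# «REALITY-PINV AT Δ₁ᴾ, GENERIC J-TERM»: THE THREE REALITY ROWS OF `Δ₁ᴾ = Pᴾᵀ(Δ^η + T_J)Pᴾ` FOR ANY J-TERM SLOT `T_J`, MODULO `T_J`'S OWN ROWS, AND THE KNIT'S `h𝒢R` ∕ `hH₁R`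
# CLAUSES AT THAT SLOT (part 2b = ✓`…RealityPInvJTermT3`: the J-term of record `T_Jᴾ` and `DeltaOnePJ`, unconditional)

Cell `ym3-torus`, width seat `ym3-torus-px3` (gen 2; EX namer ★w2-19200 g6 cascade P0–P6 (P3) + SLOT WORD 2026-08-28T20:48:46Z «`𝒢f∕H₁f` live at print's Δ₁ — `DeltaOnePJ`» + 21:03:43Z
«P3 PRECISELY … for `Δx := DeltaPiSlotP U₀` AND `Δx := DeltaOnePJ U₀`»).  Part 1 = ✓`Prop7SectET3RealityPInv` (the `Δ_πᴾ` half).  THEOREMS ONLY (0 `def`, 0 `sorry`);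
`--supports stmt-QuantumFields-19200 --as helper`; count-neutral.  YM₃ on T³ is a ladder rung (R3), NOT the Clay problem; nothing here is a claim about the stub, the crux, d = 4 or
the mass gap.

THE PRINT.  [Balaban1985BackgroundPropagators] (3.127)–(3.129) p. 421 (`Δ₁ = Pᵀ(Δ + T_J)P`, the J-term `−2⟨HC⁽²⁾(A), J⟩`, `G₁`, `H₁`), (3.119) p. 419, (3.126) p. 420, p. 393 «The operators …
are real»; [Balaban1985Variational] (51) p. 286, (103) p. 293, (110)–(111) p. 294.  HONESTY CLAUSE (RULING g28-№4 AMENDMENT): `G′ᴾ` is the pinv of the TREE's `Δ′_a` (finite-rank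
off print's); reality is insensitive to that bookkeeping.

WHAT THIS FILE PROVES (sorry-free, no definition; the texts of ✓`Prop7SectET3DeltaOneT3SlotRealityRows` + ✓`…DeltaOneT3JTermRows`∕`…RowsRegPr` at the pinv letters `Pᴾ`, `H46P`,
`T_Jᴾ`, with `ha : 0 ≤ a` replacing the vacuous class; [folklore] bookkeeping except where cited).
* (glue for the J-term letters — `tjFormP_apply`, `tjSesqP_apply`, `inner_TJP_left`, `TJSlotP_apply`, `DeltaOnePJ_def` — is ★px16 g2's ✓`…SectET3DeltaOneT3PInvGlue`, imported.)
* §2 GENERIC: ★★`DeltaOneP_comm (TJ) (ha) (hΔη) (hT)` — `Δ₁ᴾ` commutes with every additive (anti-)unitary involution triple its data (`D`, `Q`, `Δ^η`, `T_J`) commute with;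
  `DeltaOneP_isSymmetric (hTsymm)`.
* §3 the σ-ROW and TRACELESS ROW of the slot `DeltaOneP TJ` modulo the J-term's own rows: `DeltaOneP_toL2_star_of_rows∕_of_regPr (hT)`, `trace_DeltaOneP_toL2_eq_zero_of_rows∕_of_regPr
  (hTtr hTsymm)`; ★`H1f_isHermitian_traceless_at_regPr_DeltaOneP`, ★`frakGfR_isHermitian_traceless_at_regPr_DeltaOneP` (modulo `hT hTtr hTsymm`).
HONEST SCOPE.  Reality bookkeeping only; no estimate; `hPos₁`∕`hPosπ` (Thm 3.11) untouched; the stub stays open.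

References: T. Bałaban, CMP 99 (1985) 389–434 [Balaban1985BackgroundPropagators] ((3.7) p.391, (3.11)–(3.14) pp.392–393, (3.119) p.419, (3.126)–(3.129) pp.420–421, p.393); CMP 102 (1985)
277–309 [Balaban1985Variational] ((51) p.286, (103) p.293, (110)–(111) p.294).
-/

set_option autoImplicit false

noncomputable section

open scoped InnerProductSpace ComplexConjugate Matrix.Norms.L2Operator BigOperators

namespace Summit.QuantumFields.YangMills.Theorems.Prop7SectET3RealityPInvOne

open Literature.MathematicalPhysics.QuantumFieldTheory.Balaban1983to89
open Literature.MathematicalPhysics.QuantumFieldTheory.Balaban1983to89.T3ContinuumYM3Torus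
open T3SectALandauChart (eta eta_pos)
open T3PrintedRegularMinimiser (RegPr)
open B9SectCLatticeCarrier (Bond)
open B9Eq311L2Pairing (WL2)
open B11Eq103H1Complex (SiteL2K BondL2K)
open B11Eq115Space (NegSup NegSize JetSup)
open Summit.QuantumFields.YangMills.Theorems.Prop7SectET3Transport (periodsT3 siteEquiv bondEquiv bgOfCfg)
open Summit.QuantumFields.YangMills.Theorems.Prop7SectET3HilbertLetters (W₂ frobEquiv toL2 toL2S toL2B QL2 DL2 DstarL2 QL2_toL2 inner_toL2 inner_toL2B adjoint_DL2 toL2_symm_apply)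
open Summit.QuantumFields.YangMills.Theorems.Prop7SectET3CurvedPropagators (frakGfR H1f Hf)
open Summit.QuantumFields.YangMills.Theorems.Prop7SectET3WilsonHessian (DeltaEta DeltaEta_isSymmetric DeltaEta_toL2_star toL2CLM inner_toL2_star_left)
open Summit.QuantumFields.YangMills.Theorems.Prop7SectET3DeltaPiPInv (gaugeCorrP DeltaPiP DeltaPiSlotP H46P DeltaPiP_isSymmetric)
open Summit.QuantumFields.YangMills.Theorems.Prop7SectET3DeltaOnePInv (DeltaOneP H46LP tjFormP tjSesqP TJP TJSlotP DeltaOnePJ DeltaOneP_apply inner_DeltaOneP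
  H46LP_apply tjFormP_apply tjSesqP_apply inner_TJP_left TJSlotP_apply DeltaOnePJ_def)
open Summit.QuantumFields.YangMills.Theorems.Prop7SectET3DeltaOne (actionGrad avgHess avgHess_def actionGrad_star avgHess_apply_smul_one_eq_zero_of_regPr)
open Summit.QuantumFields.YangMills.Theorems.Prop7SymAvgTwSym (QTwS QTwS_star_comm_of_regPr QTwS_scalar_of_regPr QTwS_traceless_of_regPr)
open Summit.QuantumFields.YangMills.Theorems.Prop7SectET3PropagatorsReality (adjoint_comm_of_kind map_zero_of_map_add map_sub_of_map_add)
open Summit.QuantumFields.YangMills.Theorems.Prop7SectET3HilbertLettersReality (toL2_star_star toL2_star_add toL2_star_smul_real inner_toL2_star toL2S_star_star toL2S_star_add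
  toL2S_star_smul_real inner_toL2S_star toL2B_star_star toL2B_star_add toL2B_star_smul_real inner_toL2B_star DL2_star_comm QL2_star_comm_of trace_DL2_apply_eq_zero)
open Summit.QuantumFields.YangMills.Theorems.Prop7H46RealityTrace (reflection_comm_of_mapsTo mapsTo_orthogonal_of_adjoint exists_smul_one_of_trace_orthogonal trace_conjTranspose_mul_smul_one
  trace_DstarL2_apply_eq_zero)
open Summit.QuantumFields.YangMills.Theorems.Prop7H46Reality (Hf_star_comm)
open Summit.QuantumFields.YangMills.Theorems.Prop7WilsonHessianSectorRows (trace_DeltaEta_toL2_eq_zero)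
open Summit.QuantumFields.YangMills.Theorems.Prop7FrakGReality (frakGfR_isHermitian_traceless_at_regPr)
open Summit.QuantumFields.YangMills.Theorems.Prop7HfRealityTrace (H1f_isHermitian_traceless_at_regPr)
open Summit.QuantumFields.YangMills.Theorems.Prop7QTwSHessianReality (fderiv_fderiv_logChartTwS_symm_of_regPr fderiv_fderiv_logChartTwS_star_of_traceless)
open Summit.QuantumFields.YangMills.Theorems.Prop7SectET3RealityPInv (gaugeCorrP_comm DeltaPiSlotP_toL2_star_of_rows)

variable (F : T3Family) (n K : ℕ) (h : n ≤ K) (c₀ cB a : ℝ) [Fact (0 < c₀)] [Fact (0 < cB)]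
variable (TJ : GaugeField (F.P K) 0 (Matrix.specialUnitaryGroup (Fin 2) ℂ) → (BondL2K ℂ 3 (periodsT3 F K) c₀ W₂ →ₗ[ℂ] BondL2K ℂ 3 (periodsT3 F K) c₀ W₂))
variable (U₀ : GaugeField (F.P K) 0 (Matrix.specialUnitaryGroup (Fin 2) ℂ))

/-! ## §2 `Δ₁ᴾ = Pᴾᵀ(Δ^η + T_J)Pᴾ` commutes with every (anti-)unitary involution triple its data commute with -/

section Generic

variable (σE : BondL2K ℂ 3 (periodsT3 F K) c₀ W₂ → BondL2K ℂ 3 (periodsT3 F K) c₀ W₂)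
variable (σS : SiteL2K ℂ 3 (periodsT3 F K) c₀ W₂ → SiteL2K ℂ 3 (periodsT3 F K) c₀ W₂)
variable (σF : WL2 ℂ (fun _ : PBond (F.P n) 0 => cB) W₂ → WL2 ℂ (fun _ : PBond (F.P n) 0 => cB) W₂)

/-- ★★ **`Δ₁ᴾ = Pᴾᵀ(Δ^η + T_J)Pᴾ` IS REAL WHEN `Δ^η_{U₀}` AND `T_J(U₀)` ARE** (and the data `D`, `Q` are; `0 ≤ a`): `Pᴾ` commutes by ✓`gaugeCorrP_comm`, `Pᴾᵀ = Pᴾ†` by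
✓`adjoint_comm_of_kind`, the middle factor by additivity of `σ_E` — the text of ✓`DeltaOne_comm` at the pinv letter. [cite: Balaban1985BackgroundPropagators, (3.118)–(3.120) p.419, (3.127)–(3.128) p.421] -/
theorem DeltaOneP_comm (ha : 0 ≤ a)
    (hkind : ((∀ x y : BondL2K ℂ 3 (periodsT3 F K) c₀ W₂, ⟪σE x, σE y⟫_ℂ = ⟪y, x⟫_ℂ) ∧ (∀ x y : SiteL2K ℂ 3 (periodsT3 F K) c₀ W₂, ⟪σS x, σS y⟫_ℂ = ⟪y, x⟫_ℂ) ∧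
        (∀ x y : WL2 ℂ (fun _ : PBond (F.P n) 0 => cB) W₂, ⟪σF x, σF y⟫_ℂ = ⟪y, x⟫_ℂ)) ∨
      ((∀ x y : BondL2K ℂ 3 (periodsT3 F K) c₀ W₂, ⟪σE x, σE y⟫_ℂ = ⟪x, y⟫_ℂ) ∧ (∀ x y : SiteL2K ℂ 3 (periodsT3 F K) c₀ W₂, ⟪σS x, σS y⟫_ℂ = ⟪x, y⟫_ℂ) ∧
        (∀ x y : WL2 ℂ (fun _ : PBond (F.P n) 0 => cB) W₂, ⟪σF x, σF y⟫_ℂ = ⟪x, y⟫_ℂ)))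
    (hEadd : ∀ x y, σE (x + y) = σE x + σE y) (hSadd : ∀ x y, σS (x + y) = σS x + σS y) (hFadd : ∀ x y, σF (x + y) = σF x + σF y)
    (hE2 : ∀ x, σE (σE x) = x) (hS2 : ∀ s, σS (σS s) = s) (hF2 : ∀ y, σF (σF y) = y)
    (hSsmul : ∀ (r : ℝ) (s : SiteL2K ℂ 3 (periodsT3 F K) c₀ W₂), σS (((r : ℝ) : ℂ) • s) = ((r : ℝ) : ℂ) • σS s)
    (hD : ∀ s, DL2 F n K c₀ U₀ (σS s) = σE (DL2 F n K c₀ U₀ s))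
    (hQ : ∀ x, QL2 F n K h c₀ cB U₀ (σE x) = σF (QL2 F n K h c₀ cB U₀ x))
    (hΔη : ∀ x, DeltaEta F n K c₀ U₀ (σE x) = σE (DeltaEta F n K c₀ U₀ x))
    (hT : ∀ x, TJ U₀ (σE x) = σE (TJ U₀ x)) (x : BondL2K ℂ 3 (periodsT3 F K) c₀ W₂) :
    DeltaOneP F n K h c₀ cB a TJ U₀ (σE x) = σE (DeltaOneP F n K h c₀ cB a TJ U₀ x) := by
  have hP := gaugeCorrP_comm F n K h c₀ cB a U₀ σE σS σF hkind hEadd hSadd hFadd hE2 hS2 hF2 hSsmul hD hQ ha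
  have hPa : ∀ y, LinearMap.adjoint (gaugeCorrP F n K h c₀ cB a U₀) (σE y) = σE (LinearMap.adjoint (gaugeCorrP F n K h c₀ cB a U₀) y) :=
    adjoint_comm_of_kind (gaugeCorrP F n K h c₀ cB a U₀) σE σE (hkind.elim (fun hk => Or.inl ⟨hk.1, hk.1⟩) (fun hk => Or.inr ⟨hk.1, hk.1⟩)) hE2 hE2 hP
  rw [DeltaOneP_apply, DeltaOneP_apply, hP, hΔη, hT, ← hEadd, ← hPa]

end Generic

/-- **`Δ₁ᴾ = Pᴾᵀ(Δ^η + T_J)Pᴾ` IS SYMMETRIC for a symmetric J-term** (twin of ✓`DeltaOne_isSymmetric`). [cite: Balaban1985BackgroundPropagators, (3.128) p.421] -/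
theorem DeltaOneP_isSymmetric (hTsymm : (TJ U₀).IsSymmetric) : (DeltaOneP F n K h c₀ cB a TJ U₀).IsSymmetric := by
  intro x y
  have hs := DeltaEta_isSymmetric (n := n) (c₀ := c₀) U₀ (gaugeCorrP F n K h c₀ cB a U₀ x) (gaugeCorrP F n K h c₀ cB a U₀ y)
  simp only [ContinuousLinearMap.coe_coe] at hs
  rw [← inner_conj_symm, inner_DeltaOneP, map_add, inner_conj_symm, inner_conj_symm, hs, hTsymm, ← inner_DeltaOneP]

/-! ## §3 The σ-row and the traceless row of the slot `Δ₁ᴾ` modulo the J-term's rows; the clauses at the slot -/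

/-- ★ **THE `Δ₁ᴾ`-SLOT σ-ROW `hΔx` FROM `T_J`'S σ-ROW** (`σ = toL2 ∘ star ∘ toL2⁻¹`; `QTwS` star row `hQ`; `Δ^η`'s row ✓`DeltaEta_toL2_star` inside).
[cite: Balaban1985BackgroundPropagators, (3.127)–(3.128) p.421, p.393; Balaban1985Variational, (51) p.286] -/
theorem DeltaOneP_toL2_star_of_rows (ha : 0 ≤ a)
    (hQ : ∀ A : PBond (F.P K) 0 → Matrix (Fin 2) (Fin 2) ℂ, QTwS F n K h U₀ (star A) = star (QTwS F n K h U₀ A))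
    (hT : ∀ f : BondL2K ℂ 3 (periodsT3 F K) c₀ W₂, TJ U₀ (toL2 F K c₀ (star ((toL2 F K c₀).symm f))) = toL2 F K c₀ (star ((toL2 F K c₀).symm (TJ U₀ f)))) :
    ∀ f : BondL2K ℂ 3 (periodsT3 F K) c₀ W₂,
      DeltaOneP F n K h c₀ cB a TJ U₀ (toL2 F K c₀ (star ((toL2 F K c₀).symm f))) = toL2 F K c₀ (star ((toL2 F K c₀).symm (DeltaOneP F n K h c₀ cB a TJ U₀ f))) :=
  DeltaOneP_comm F n K h c₀ cB a TJ U₀ (fun f => toL2 F K c₀ (star ((toL2 F K c₀).symm f))) (fun g => toL2S F K c₀ (star ((toL2S F K c₀).symm g)))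
    (fun y => toL2B F n cB (star ((toL2B F n cB).symm y))) ha (Or.inl ⟨inner_toL2_star, inner_toL2S_star, inner_toL2B_star⟩)
    toL2_star_add toL2S_star_add toL2B_star_add toL2_star_star toL2S_star_star toL2B_star_star toL2S_star_smul_real (DL2_star_comm U₀) (QL2_star_comm_of U₀ hQ)
    (fun f => by
      have key := DeltaEta_toL2_star (F := F) (n := n) (K := K) (c₀ := c₀) U₀ ((toL2 F K c₀).symm f)
      rwa [LinearEquiv.apply_symm_apply] at key)
    hT

/-- **THE `Δ₁ᴾ`-SLOT σ-ROW AT `U₀ ∈ 𝔘_k(ε₀)`** in the windows `10⁹L²e ≤ 1`, `10¹²L³ε₀ ≤ 1` (★w5's ✓`QTwS_star_comm_of_regPr`), modulo `T_J`'s σ-row only.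
[cite: Balaban1985BackgroundPropagators, (3.128) p.421; Balaban1985Variational, (51) p.286] -/
theorem DeltaOneP_toL2_star_of_regPr [Fact (0 < (F.L : ℝ))] [Fact (0 < ((F.L : ℝ)⁻¹) ^ (K - n))] (ha : 0 ≤ a)
    {ε₀ e : ℝ} (hε₀ : 0 < ε₀) (he : 0 < e) (hWe : 10 ^ 9 * (F.L : ℝ) ^ 2 * e ≤ 1) (hWε : 10 ^ 12 * (F.L : ℝ) ^ 3 * ε₀ ≤ 1) (hreg : RegPr F n K ε₀ U₀)
    (hT : ∀ f : BondL2K ℂ 3 (periodsT3 F K) c₀ W₂, TJ U₀ (toL2 F K c₀ (star ((toL2 F K c₀).symm f))) = toL2 F K c₀ (star ((toL2 F K c₀).symm (TJ U₀ f)))) :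
    ∀ f : BondL2K ℂ 3 (periodsT3 F K) c₀ W₂,
      DeltaOneP F n K h c₀ cB a TJ U₀ (toL2 F K c₀ (star ((toL2 F K c₀).symm f))) = toL2 F K c₀ (star ((toL2 F K c₀).symm (DeltaOneP F n K h c₀ cB a TJ U₀ f))) :=
  DeltaOneP_toL2_star_of_rows F n K h c₀ cB a TJ U₀ ha (QTwS_star_comm_of_regPr F h hε₀ he hWe hWε U₀ hreg) hT

/-- ★ **THE `Δ₁ᴾ`-SLOT TRACELESS ROW `hΔtr` FROM `T_J`'S TRACELESS ROW AND SYMMETRY**: traceless `A` give traceless `toL2⁻¹(Δ₁ᴾ(U₀)(toL2 A))`, given the `QTwS` sector rows `hQtr`∕`hQsc`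
— §2 at the reflections of the traceless sectors (the text of ✓`trace_DeltaOne_toL2_eq_zero_of_rows`). [cite: Balaban1985BackgroundPropagators, (3.127)–(3.128) p.421, p.393; Balaban1985Variational, (51) p.286] -/
theorem trace_DeltaOneP_toL2_eq_zero_of_rows (ha : 0 ≤ a)
    (hQtr : ∀ A : PBond (F.P K) 0 → Matrix (Fin 2) (Fin 2) ℂ, (∀ b, (A b).trace = 0) → ∀ c, (QTwS F n K h U₀ A c).trace = 0)
    (hQsc : ∀ c : PBond (F.P K) 0 → ℂ, ∃ d : PBond (F.P n) 0 → ℂ, QTwS F n K h U₀ (fun b => c b • (1 : Matrix (Fin 2) (Fin 2) ℂ)) = fun c' => d c' • 1)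
    (hTtr : ∀ A : PBond (F.P K) 0 → Matrix (Fin 2) (Fin 2) ℂ, (∀ b, (A b).trace = 0) → ∀ b, ((toL2 F K c₀).symm (TJ U₀ (toL2 F K c₀ A)) b).trace = 0)
    (hTsymm : (TJ U₀).IsSymmetric) :
    ∀ A : PBond (F.P K) 0 → Matrix (Fin 2) (Fin 2) ℂ, (∀ b, (A b).trace = 0) → ∀ b, ((toL2 F K c₀).symm (DeltaOneP F n K h c₀ cB a TJ U₀ (toL2 F K c₀ A)) b).trace = 0 := by
  intro A hA b
  -- the traceless sectors of the three carriers
  let VE : Submodule ℂ (BondL2K ℂ 3 (periodsT3 F K) c₀ W₂) :=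
    { carrier := {f | ∀ b, ((toL2 F K c₀).symm f b).trace = 0}
      add_mem' := fun {f g} hf hg b => by rw [map_add, Pi.add_apply, Matrix.trace_add, hf b, hg b, add_zero]
      zero_mem' := fun b => by rw [map_zero, Pi.zero_apply, Matrix.trace_zero]
      smul_mem' := fun r f hf b => by rw [map_smul, Pi.smul_apply, Matrix.trace_smul, hf b, smul_zero] }
  let VS : Submodule ℂ (SiteL2K ℂ 3 (periodsT3 F K) c₀ W₂) :=
    { carrier := {g | ∀ x, ((toL2S F K c₀).symm g x).trace = 0}
      add_mem' := fun {f g} hf hg x => by rw [map_add, Pi.add_apply, Matrix.trace_add, hf x, hg x, add_zero]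
      zero_mem' := fun x => by rw [map_zero, Pi.zero_apply, Matrix.trace_zero]
      smul_mem' := fun r f hf x => by rw [map_smul, Pi.smul_apply, Matrix.trace_smul, hf x, smul_zero] }
  let VF : Submodule ℂ (WL2 ℂ (fun _ : PBond (F.P n) 0 => cB) W₂) :=
    { carrier := {y | ∀ c, ((toL2B F n cB).symm y c).trace = 0}
      add_mem' := fun {f g} hf hg c => by rw [map_add, Pi.add_apply, Matrix.trace_add, hf c, hg c, add_zero]
      zero_mem' := fun c => by rw [map_zero, Pi.zero_apply, Matrix.trace_zero]
      smul_mem' := fun r f hf c => by rw [map_smul, Pi.smul_apply, Matrix.trace_smul, hf c, smul_zero] }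
  haveI : CompleteSpace VE := FiniteDimensional.complete ℂ VE
  haveI : CompleteSpace VS := FiniteDimensional.complete ℂ VS
  haveI : CompleteSpace VF := FiniteDimensional.complete ℂ VF
  -- membership through the route-carrier readings
  have memVE : ∀ A : PBond (F.P K) 0 → Matrix (Fin 2) (Fin 2) ℂ, toL2 F K c₀ A ∈ VE ↔ ∀ b, (A b).trace = 0 := fun A => by
    change (∀ b, ((toL2 F K c₀).symm (toL2 F K c₀ A) b).trace = 0) ↔ _
    rw [LinearEquiv.symm_apply_apply]
  have memVF : ∀ B : PBond (F.P n) 0 → Matrix (Fin 2) (Fin 2) ℂ, toL2B F n cB B ∈ VF ↔ ∀ c, (B c).trace = 0 := fun B => by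
    change (∀ c, ((toL2B F n cB).symm (toL2B F n cB B) c).trace = 0) ↔ _
    rw [LinearEquiv.symm_apply_apply]
  -- the complements: scalar-valued fields
  have scalar_mem_VFc : ∀ d : PBond (F.P n) 0 → ℂ, toL2B F n cB (fun c => d c • (1 : Matrix (Fin 2) (Fin 2) ℂ)) ∈ VFᗮ := by
    intro d
    rw [Submodule.mem_orthogonal]
    intro v hv
    obtain ⟨B, rfl⟩ : ∃ B, v = toL2B F n cB B := ⟨(toL2B F n cB).symm v, ((toL2B F n cB).apply_symm_apply v).symm⟩
    rw [inner_toL2B]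
    refine mul_eq_zero_of_right _ (Finset.sum_eq_zero fun c _ => trace_conjTranspose_mul_smul_one ((memVF B).1 hv c) (d c))
  have exists_scalar_of_mem_VEc : ∀ u ∈ VEᗮ, ∃ c : PBond (F.P K) 0 → ℂ, u = toL2 F K c₀ (fun b => c b • (1 : Matrix (Fin 2) (Fin 2) ℂ)) := by
    intro u hu
    obtain ⟨A, rfl⟩ : ∃ A, u = toL2 F K c₀ A := ⟨(toL2 F K c₀).symm u, ((toL2 F K c₀).apply_symm_apply u).symm⟩
    have hpt : ∀ b, ∃ c : ℂ, A b = c • (1 : Matrix (Fin 2) (Fin 2) ℂ) := by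
      intro b
      refine exists_smul_one_of_trace_orthogonal (A b) fun X hX => ?_
      have hmem : toL2 F K c₀ (Pi.single b X) ∈ VE := (memVE _).2 fun b' => by
        by_cases hb : b' = b
        · subst hb; rw [Pi.single_eq_same]; exact hX
        · rw [Pi.single_eq_of_ne hb, Matrix.trace_zero]
      have h0 := (Submodule.mem_orthogonal _ _).1 hu _ hmem
      rw [inner_toL2, Finset.sum_eq_single b (fun b' _ hb' => by rw [Pi.single_eq_of_ne hb', Matrix.conjTranspose_zero, Matrix.zero_mul, Matrix.trace_zero])
        (fun hb => (hb (Finset.mem_univ b)).elim), Pi.single_eq_same] at h0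
      have hc₀ : ((c₀ : ℝ) : ℂ) ≠ 0 := Complex.ofReal_ne_zero.2 (ne_of_gt (Fact.out : 0 < c₀))
      exact (mul_eq_zero.1 h0).resolve_left hc₀
    choose c hc using hpt
    exact ⟨c, congrArg _ (funext hc)⟩
  -- DATA ROWS in sector form
  have hD_V : ∀ g ∈ VS, DL2 F n K c₀ U₀ g ∈ VE := by
    intro g hg
    obtain ⟨l, rfl⟩ : ∃ l, g = toL2S F K c₀ l := ⟨(toL2S F K c₀).symm g, ((toL2S F K c₀).apply_symm_apply g).symm⟩
    have hl : ∀ x, (l x).trace = 0 := fun x => by have := hg x; rwa [LinearEquiv.symm_apply_apply] at this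
    exact fun b' => trace_DL2_apply_eq_zero U₀ l hl b'
  have hDstar_V : ∀ f ∈ VE, LinearMap.adjoint (DL2 F n K c₀ U₀) f ∈ VS := by
    intro f hf
    obtain ⟨A, rfl⟩ : ∃ A, f = toL2 F K c₀ A := ⟨(toL2 F K c₀).symm f, ((toL2 F K c₀).apply_symm_apply f).symm⟩
    rw [adjoint_DL2]
    exact fun x => trace_DstarL2_apply_eq_zero F n K c₀ U₀ A ((memVE A).1 hf) x
  have hD_Vc : ∀ u ∈ VSᗮ, DL2 F n K c₀ U₀ u ∈ VEᗮ := fun u hu => mapsTo_orthogonal_of_adjoint _ VS VE hDstar_V hu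
  have hQ_V : ∀ f ∈ VE, QL2 F n K h c₀ cB U₀ f ∈ VF := by
    intro f hf
    obtain ⟨A, rfl⟩ : ∃ A, f = toL2 F K c₀ A := ⟨(toL2 F K c₀).symm f, ((toL2 F K c₀).apply_symm_apply f).symm⟩
    rw [QL2_toL2]
    exact (memVF _).2 (hQtr A ((memVE A).1 hf))
  have hQ_Vc : ∀ u ∈ VEᗮ, QL2 F n K h c₀ cB U₀ u ∈ VFᗮ := by
    intro u hu
    obtain ⟨c, rfl⟩ := exists_scalar_of_mem_VEc u hu
    obtain ⟨d, hd⟩ := hQsc c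
    rw [QL2_toL2, hd]
    exact scalar_mem_VFc d
  have hΔ_V : ∀ f ∈ VE, (DeltaEta F n K c₀ U₀ : BondL2K ℂ 3 (periodsT3 F K) c₀ W₂ →ₗ[ℂ] BondL2K ℂ 3 (periodsT3 F K) c₀ W₂) f ∈ VE := by
    intro f hf
    obtain ⟨A, rfl⟩ : ∃ A, f = toL2 F K c₀ A := ⟨(toL2 F K c₀).symm f, ((toL2 F K c₀).apply_symm_apply f).symm⟩
    exact fun b' => trace_DeltaEta_toL2_eq_zero U₀ A ((memVE A).1 hf) b'
  have hΔ_Vc : ∀ u ∈ VEᗮ, (DeltaEta F n K c₀ U₀ : BondL2K ℂ 3 (periodsT3 F K) c₀ W₂ →ₗ[ℂ] BondL2K ℂ 3 (periodsT3 F K) c₀ W₂) u ∈ VEᗮ := fun u hu =>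
    mapsTo_orthogonal_of_adjoint _ VE VE (fun v hv => by rw [(DeltaEta_isSymmetric U₀).adjoint_eq]; exact hΔ_V v hv) hu
  have hT_V : ∀ f ∈ VE, TJ U₀ f ∈ VE := by
    intro f hf
    obtain ⟨A, rfl⟩ : ∃ A, f = toL2 F K c₀ A := ⟨(toL2 F K c₀).symm f, ((toL2 F K c₀).apply_symm_apply f).symm⟩
    exact fun b' => hTtr A ((memVE A).1 hf) b'
  have hT_Vc : ∀ u ∈ VEᗮ, TJ U₀ u ∈ VEᗮ := fun u hu =>
    mapsTo_orthogonal_of_adjoint _ VE VE (fun v hv => by rw [hTsymm.adjoint_eq]; exact hT_V v hv) hu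
  -- the reflections intertwined by the data
  have hD : ∀ s, DL2 F n K c₀ U₀ (VS.reflection s) = VE.reflection (DL2 F n K c₀ U₀ s) := reflection_comm_of_mapsTo VS VE _ hD_V hD_Vc
  have hQ : ∀ x, QL2 F n K h c₀ cB U₀ (VE.reflection x) = VF.reflection (QL2 F n K h c₀ cB U₀ x) := reflection_comm_of_mapsTo VE VF _ hQ_V hQ_Vc
  have hΔη : ∀ x, DeltaEta F n K c₀ U₀ (VE.reflection x) = VE.reflection (DeltaEta F n K c₀ U₀ x) := fun x => by
    have := reflection_comm_of_mapsTo VE VE _ hΔ_V hΔ_Vc x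
    simpa only [ContinuousLinearMap.coe_coe] using this
  have hT : ∀ x, TJ U₀ (VE.reflection x) = VE.reflection (TJ U₀ x) := reflection_comm_of_mapsTo VE VE _ hT_V hT_Vc
  -- §2 at the unitary (reflection) triple
  have key := DeltaOneP_comm F n K h c₀ cB a TJ U₀ (fun x => VE.reflection x) (fun s => VS.reflection s) (fun y => VF.reflection y) ha
    (Or.inr ⟨fun x y => VE.reflection.inner_map_map x y, fun x y => VS.reflection.inner_map_map x y, fun x y => VF.reflection.inner_map_map x y⟩)
    (fun x y => map_add _ x y) (fun x y => map_add _ x y) (fun x y => map_add _ x y)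
    (fun x => VE.reflection_reflection x) (fun s => VS.reflection_reflection s) (fun y => VF.reflection_reflection y)
    (fun r s => map_smul _ _ s) hD hQ hΔη hT (toL2 F K c₀ A)
  have hAmem : toL2 F K c₀ A ∈ VE := (memVE A).2 hA
  rw [Submodule.reflection_mem_subspace_eq_self hAmem] at key
  exact ((Submodule.reflection_eq_self_iff _).1 key.symm) b

/-- **THE `Δ₁ᴾ`-SLOT TRACELESS ROW AT `U₀ ∈ 𝔘_k(ε₀)`** in the windows (★w5's ✓`QTwS_traceless_of_regPr`∕✓`QTwS_scalar_of_regPr`), modulo `T_J`'s traceless row and symmetry.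
[cite: Balaban1985BackgroundPropagators, (3.128) p.421; Balaban1985Variational, (51) p.286] -/
theorem trace_DeltaOneP_toL2_eq_zero_of_regPr [Fact (0 < (F.L : ℝ))] [Fact (0 < ((F.L : ℝ)⁻¹) ^ (K - n))] (ha : 0 ≤ a)
    {ε₀ e : ℝ} (hε₀ : 0 < ε₀) (he : 0 < e) (hWe : 10 ^ 9 * (F.L : ℝ) ^ 2 * e ≤ 1) (hWε : 10 ^ 12 * (F.L : ℝ) ^ 3 * ε₀ ≤ 1) (hreg : RegPr F n K ε₀ U₀)
    (hTtr : ∀ A : PBond (F.P K) 0 → Matrix (Fin 2) (Fin 2) ℂ, (∀ b, (A b).trace = 0) → ∀ b, ((toL2 F K c₀).symm (TJ U₀ (toL2 F K c₀ A)) b).trace = 0)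
    (hTsymm : (TJ U₀).IsSymmetric) :
    ∀ A : PBond (F.P K) 0 → Matrix (Fin 2) (Fin 2) ℂ, (∀ b, (A b).trace = 0) → ∀ b, ((toL2 F K c₀).symm (DeltaOneP F n K h c₀ cB a TJ U₀ (toL2 F K c₀ A)) b).trace = 0 :=
  trace_DeltaOneP_toL2_eq_zero_of_rows F n K h c₀ cB a TJ U₀ ha (QTwS_traceless_of_regPr F h hε₀ he hWe hWε U₀ hreg) (QTwS_scalar_of_regPr F h hε₀ hWε U₀ hreg) hTtr hTsymm

/-- ★ **THE KNIT'S `hH₁R` CLAUSE AT THE SLOT `Δ₁ᴾ`, MODULO THE J-TERM'S THREE ROWS** — ★w4's generic ✓`H1f_isHermitian_traceless_at_regPr` at `Δx := DeltaOneP … TJ` fed with the rows above and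
`DeltaOneP_isSymmetric`; displayed: `T_J`'s σ-row `hT`, traceless row `hTtr`, symmetry `hTsymm` (twin of ✓`H1f_isHermitian_traceless_at_regPr_DeltaOne`).
[cite: Balaban1985Variational, (103) p.293, (110) p.294, (51) p.286; Balaban1985BackgroundPropagators, (3.128)–(3.129) p.421] -/
theorem H1f_isHermitian_traceless_at_regPr_DeltaOneP [Fact (0 < (F.L : ℝ))] [Fact (0 < ((F.L : ℝ)⁻¹) ^ (K - n))] (ha : 0 ≤ a)
    {ε₀ e : ℝ} (hε₀ : 0 < ε₀) (he : 0 < e) (hWe : 10 ^ 9 * (F.L : ℝ) ^ 2 * e ≤ 1) (hWε : 10 ^ 12 * (F.L : ℝ) ^ 3 * ε₀ ≤ 1) (hreg : RegPr F n K ε₀ U₀)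
    (hT : ∀ f : BondL2K ℂ 3 (periodsT3 F K) c₀ W₂, TJ U₀ (toL2 F K c₀ (star ((toL2 F K c₀).symm f))) = toL2 F K c₀ (star ((toL2 F K c₀).symm (TJ U₀ f))))
    (hTtr : ∀ A : PBond (F.P K) 0 → Matrix (Fin 2) (Fin 2) ℂ, (∀ b, (A b).trace = 0) → ∀ b, ((toL2 F K c₀).symm (TJ U₀ (toL2 F K c₀ A)) b).trace = 0)
    (hTsymm : (TJ U₀).IsSymmetric) :
    ∀ B : PBond (F.P n) 0 → Matrix (Fin 2) (Fin 2) ℂ, (∀ c, (B c).IsHermitian ∧ (B c).trace = 0) →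
      ∀ x : Bond 3 (periodsT3 F K), (JetSup.equiv _ _ _ (H1f F n K h c₀ cB a (DeltaOneP F n K h c₀ cB a TJ) U₀ B) x).IsHermitian ∧
        (JetSup.equiv _ _ _ (H1f F n K h c₀ cB a (DeltaOneP F n K h c₀ cB a TJ) U₀ B) x).trace = 0 :=
  H1f_isHermitian_traceless_at_regPr F n K h c₀ cB a (DeltaOneP F n K h c₀ cB a TJ) hε₀ he hWe hWε U₀ hreg
    (DeltaOneP_toL2_star_of_regPr F n K h c₀ cB a TJ U₀ ha hε₀ he hWe hWε hreg hT)
    (trace_DeltaOneP_toL2_eq_zero_of_regPr F n K h c₀ cB a TJ U₀ ha hε₀ he hWe hWε hreg hTtr hTsymm) (DeltaOneP_isSymmetric F n K h c₀ cB a TJ U₀ hTsymm)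

/-- ★ **THE KNIT'S `h𝒢R` CLAUSE AT THE SLOT `Δ₁ᴾ`, MODULO THE J-TERM'S THREE ROWS** (generic ✓`frakGfR_isHermitian_traceless_at_regPr` at `Δx := DeltaOneP … TJ`; twin of
✓`frakGfR_isHermitian_traceless_at_regPr_DeltaOne`). [cite: Balaban1985Variational, (110)–(111) p.294, (51) p.286; Balaban1985BackgroundPropagators, (3.128) p.421, (3.153) p.426] -/
theorem frakGfR_isHermitian_traceless_at_regPr_DeltaOneP [Fact (0 < (F.L : ℝ))] [Fact (0 < ((F.L : ℝ)⁻¹) ^ (K - n))] (ha : 0 ≤ a)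
    {ε₀ e : ℝ} (hε₀ : 0 < ε₀) (he : 0 < e) (hWe : 10 ^ 9 * (F.L : ℝ) ^ 2 * e ≤ 1) (hWε : 10 ^ 12 * (F.L : ℝ) ^ 3 * ε₀ ≤ 1) (hreg : RegPr F n K ε₀ U₀)
    (hT : ∀ f : BondL2K ℂ 3 (periodsT3 F K) c₀ W₂, TJ U₀ (toL2 F K c₀ (star ((toL2 F K c₀).symm f))) = toL2 F K c₀ (star ((toL2 F K c₀).symm (TJ U₀ f))))
    (hTtr : ∀ A : PBond (F.P K) 0 → Matrix (Fin 2) (Fin 2) ℂ, (∀ b, (A b).trace = 0) → ∀ b, ((toL2 F K c₀).symm (TJ U₀ (toL2 F K c₀ A)) b).trace = 0)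
    (hTsymm : (TJ U₀).IsSymmetric) :
    ∀ f : NegSize (F.L : ℝ) (((F.L : ℝ)⁻¹) ^ (K - n)) (fun _ : Bond 3 (periodsT3 F K) => K - n) 3 (Matrix (Fin 2) (Fin 2) ℂ),
      (∀ b, (NegSup.equiv _ _ f b).IsHermitian ∧ (NegSup.equiv _ _ f b).trace = 0) →
      ∀ b, (JetSup.equiv _ _ _ (frakGfR F n K h c₀ cB a (DeltaOneP F n K h c₀ cB a TJ) U₀ f) b).IsHermitian ∧
        (JetSup.equiv _ _ _ (frakGfR F n K h c₀ cB a (DeltaOneP F n K h c₀ cB a TJ) U₀ f) b).trace = 0 :=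
  frakGfR_isHermitian_traceless_at_regPr F n K h c₀ cB a U₀ (DeltaOneP F n K h c₀ cB a TJ) hε₀ he hWe hWε hreg
    (DeltaOneP_toL2_star_of_regPr F n K h c₀ cB a TJ U₀ ha hε₀ he hWe hWε hreg hT)
    (trace_DeltaOneP_toL2_eq_zero_of_regPr F n K h c₀ cB a TJ U₀ ha hε₀ he hWe hWε hreg hTtr hTsymm) (DeltaOneP_isSymmetric F n K h c₀ cB a TJ U₀ hTsymm)

end Summit.QuantumFields.YangMills.Theorems.Prop7SectET3RealityPInvOne

end
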